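import Literature.NumberTheory.ConnesConsani.ScalingSitePeriodicOrbit
import Mathlib.Topology.ContinuousMap.Compact
import Mathlib.Topology.UniformSpace.CompactConvergence
import HarnessLib

/-!
# `H⁰(D)` on the periodic orbit `C_p`: slopes, breakpoints based at `1`, the `p`-adic size of
# the slopes — tools for the Riemann–Roch theorem of type II (Connes–Consani 2017, §5.4)

Topic `Literature/NumberTheory/ConnesConsani`, continuing `ScalingSitePeriodicOrbit.lean` (whose
vocabulary `IsPFraction`, `IsCpRational`, `cpOrder`, `CpDivisor`, `cpH0`, `cpSlopeNorm`,
`CpH0Level`, `CpPieces`, `fundRed` we use). Everything here is PROVED (no named facts); the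
definitions are auxiliary (`bpts`, `hinge`). This is the first half of the discharge of the named
fact `ConnesConsani2017_thm_5_17` (Riemann–Roch of type II); it formalises the elementary
statements of §5.4 of the source on which the proof of Thm. 5.17 rests:

* one-sided slopes of `f ∈ 𝒦(C_p)` exist everywhere on `(0, ∞)` and lie in `H_p`; `f` is
  continuous on `(0, ∞)` ("piecewise affine, continuous", Prop. 5.2 / proof of Prop. 5.4 (v));
* `CpPieces.ofFinset`, `IsCpRational.exists_cpPieces_base_one`: every `f ∈ 𝒦(C_p)` has piece
  data on the fundamental domain `[1, p]` containing any prescribed finite set of break points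
  ("Such a function is uniquely determined by its restriction to the fundamental domain", proof
  of Prop. 5.4 (v));
* `pFractionPadicNorm_eq` and the `p`-adic bookkeeping of Def. 5.14: `|h/p|_p = p |h|_p`;
  **Prop. 5.15 (iv)** in the scaled form used in Lemma 5.18 (ii): `‖f‖_p ≤ pⁿ` iff the slopes
  of `f` on `[1, p)` lie in `p⁻ⁿ ℤ` (`slopes_div_pow_of_cpSlopeNorm_le`,
  `cpSlopeNorm_le_of_slopes`);
* one-sided derivatives of the hinge functions `x ↦ max (x - c) 0` (the building blocks of the
  explicit elements `φ_a = max{-a(x-1), b(x-p)}` of Lemma 5.19 (ii)–(iii)).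

## References
* A. Connes, C. Consani, *Geometry of the scaling site*, Selecta Math. (N.S.) 23 (2017)
  1803–1850, §5.4 (Def. 5.14, Prop. 5.15, Def. 5.16, Thm. 5.17, Lemmas 5.18–5.19)
  [ConnesConsani2017ScalingSite] (arXiv:1603.03191, pp. 19–21).
-/

noncomputable section

open Set Filter
open scoped Topology

namespace Literature.NumberTheory.ConnesConsani

/-! ### One-sided slopes of `f ∈ 𝒦(C_p)` at every point of `(0, ∞)` -/

/-- **Slopes exist everywhere and lie in `H_p`** (Prop. 5.2 (i): "piecewise affine, continuous
functions with slopes in `H_p`"; §5.4: "the slope `h_±(pλ)` of `f` at `pλ` is `h_±(λ)/p`"): for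
`f ∈ 𝒦(C_p)` and `x > 0` the one-sided derivatives of `f` at `x` exist and belong to `H_p`.
[cite: ConnesConsani2017ScalingSite, Prop. 5.2 (i) and §5.4 (before Def. 5.14)] -/
theorem IsCpRational.exists_hasDerivWithinAt {p : ℕ} (hp : 1 < p) {f : ℝ → ℝ}
    (hf : IsCpRational p f) {x : ℝ} (hx : 0 < x) :
    ∃ sR sL : ℝ, HasDerivWithinAt f sR (Ioi x) x ∧ HasDerivWithinAt f sL (Iio x) x ∧
      IsPFraction p sR ∧ IsPFraction p sL := by
  have hp0 : 0 < p := zero_lt_one.trans hp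
  have hpR : (0 : ℝ) < p := by exact_mod_cast hp0
  obtain ⟨P⟩ := hf.nonempty_cpPieces
  obtain ⟨k, y, hy0, hy1, rfl⟩ := exists_zpow_mul_mem_Ico hp P.lam_pos hx
  rw [← P.lam_last] at hy1
  have hy : 0 < y := P.lam_pos.trans_le hy0
  have hperk : ∀ t, 0 < t → f ((p : ℝ) ^ k * t) = f t := periodic_zpow hp0 hf.1 k
  -- right slope at `y`
  obtain ⟨j, hj, hy2, hy3⟩ := P.exists_piece_right hy0 hy1
  have hR := P.hasDerivWithinAt_Ioi hj hy2 hy3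
  -- left slope at `y`
  have hL : ∃ sL, HasDerivWithinAt f sL (Iio y) y ∧ IsPFraction p sL := by
    rcases hy0.eq_or_lt with h | h
    · refine ⟨p * P.h P.n, ?_, (P.h_mem P.n le_rfl).mul_p⟩
      rw [← h]; exact P.hasDerivWithinAt_Iio_zero hp0 hf.1
    · obtain ⟨i, hi, hy4, hy5⟩ := P.exists_piece_left h hy1.le
      exact ⟨P.h i, P.hasDerivWithinAt_Iio hi hy4 hy5, P.h_mem i hi⟩
  obtain ⟨sL, hL, hsL⟩ := hL
  refine ⟨P.h j / (p : ℝ) ^ k, sL / (p : ℝ) ^ k,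
    hasDerivWithinAt_Ioi_scale (zpow_pos hpR k) hperk hy hR,
    hasDerivWithinAt_Iio_scale (zpow_pos hpR k) hperk hy hL, ?_, ?_⟩
  · rw [div_eq_mul_inv, ← zpow_neg, mul_comm]; exact (P.h_mem j hj).mul_zpow (-k)
  · rw [div_eq_mul_inv, ← zpow_neg, mul_comm]; exact hsL.mul_zpow (-k)

/-- The right slope of `f ∈ 𝒦(C_p)` at `x > 0` is attained (`derivWithin` is a genuine one-sided
derivative) and lies in `H_p`. [cite: ConnesConsani2017ScalingSite, Prop. 5.2 (i)] -/
theorem IsCpRational.hasDerivWithinAt_Ioi {p : ℕ} (hp : 1 < p) {f : ℝ → ℝ}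
    (hf : IsCpRational p f) {x : ℝ} (hx : 0 < x) :
    HasDerivWithinAt f (derivWithin f (Ioi x) x) (Ioi x) x ∧
      IsPFraction p (derivWithin f (Ioi x) x) := by
  obtain ⟨sR, sL, hR, -, hsR, -⟩ := hf.exists_hasDerivWithinAt hp hx
  rw [hR.derivWithin (uniqueDiffWithinAt_Ioi x)]
  exact ⟨hR, hsR⟩

/-- The left slope of `f ∈ 𝒦(C_p)` at `x > 0` is attained and lies in `H_p`.
[cite: ConnesConsani2017ScalingSite, Prop. 5.2 (i)] -/
theorem IsCpRational.hasDerivWithinAt_Iio {p : ℕ} (hp : 1 < p) {f : ℝ → ℝ}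
    (hf : IsCpRational p f) {x : ℝ} (hx : 0 < x) :
    HasDerivWithinAt f (derivWithin f (Iio x) x) (Iio x) x ∧
      IsPFraction p (derivWithin f (Iio x) x) := by
  obtain ⟨sR, sL, -, hL, -, hsL⟩ := hf.exists_hasDerivWithinAt hp hx
  rw [hL.derivWithin (uniqueDiffWithinAt_Iio x)]
  exact ⟨hL, hsL⟩

/-- `f ∈ 𝒦(C_p)` is continuous at every point of `(0, ∞)` ("piecewise affine, continuous").
[cite: ConnesConsani2017ScalingSite, Prop. 5.2 (i)] -/
theorem IsCpRational.continuousAt {p : ℕ} (hp : 1 < p) {f : ℝ → ℝ} (hf : IsCpRational p f)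
    {x : ℝ} (hx : 0 < x) : ContinuousAt f x := by
  obtain ⟨sR, sL, hR, hL, -, -⟩ := hf.exists_hasDerivWithinAt hp hx
  rw [continuousAt_iff_continuous_left_right]
  constructor
  · have h := hL.continuousWithinAt
    exact continuousWithinAt_Iio_iff_Iic.mp h
  · have h := hR.continuousWithinAt
    exact continuousWithinAt_Ioi_iff_Ici.mp h

/-- `f ∈ 𝒦(C_p)` is continuous on `(0, ∞)`. [cite: ConnesConsani2017ScalingSite, Prop. 5.2 (i)] -/
theorem IsCpRational.continuousOn_Ioi {p : ℕ} (hp : 1 < p) {f : ℝ → ℝ} (hf : IsCpRational p f) :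
    ContinuousOn f (Ioi 0) := fun _ hx =>
  (hf.continuousAt hp hx).continuousWithinAt

/-- The periodicity relates `x` to its representative: `f(x) = f(fundRed x)`.
[cite: ConnesConsani2017ScalingSite, Lemma 5.1 (i)] -/
theorem IsCpRational.apply_eq_apply_fundRed {p : ℕ} (hp : 1 < p) {f : ℝ → ℝ}
    (hf : IsCpRational p f) {c : ℝ} (hc : 0 < c) {x : ℝ} (hx : 0 < x) :
    f x = f (fundRed p c x) := by
  obtain ⟨h1, -, h3⟩ := fundRed_spec hp hc hx
  conv_lhs => rw [h3]
  exact periodic_zpow (zero_lt_one.trans hp) hf.1 _ _ (hc.trans_le h1)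

/-! ### Break points based at `1`: the sorted list `1 < t₁ < ⋯ < t_N < p` -/

/-- The break points `1, t₁, …, t_N, p` attached to a finite set `T = {t₁ < ⋯ < t_N} ⊂ (1, p)`
(index `0 ↦ 1`, `i ↦ tᵢ`, `N + 1` and beyond `↦ p`). [cite: ConnesConsani2017ScalingSite, proof of Prop. 5.4 (v) (the sequence `λ₀ < λ₁ < ⋯ < λ_n = pλ₀`)] -/
def bpts (p : ℕ) (T : Finset ℝ) (i : ℕ) : ℝ :=
  if i = 0 then 1 else if h : i - 1 < T.card then T.orderEmbOfFin rfl ⟨i - 1, h⟩ else p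

section Bpts

variable {p : ℕ} {T : Finset ℝ}

/-- `bpts 0 = 1`. [cite: ConnesConsani2017ScalingSite, proof of Prop. 5.4 (v)] -/
@[simp] theorem bpts_zero : bpts p T 0 = 1 := by simp [bpts]

/-- `bpts (N + 1) = p`. [cite: ConnesConsani2017ScalingSite, proof of Prop. 5.4 (v)] -/
theorem bpts_of_card_lt {i : ℕ} (hi : T.card < i) : bpts p T i = p := by
  unfold bpts
  rw [if_neg (by omega), dif_neg (by omega)]

/-- The middle break points. [cite: ConnesConsani2017ScalingSite, proof of Prop. 5.4 (v)] -/
theorem bpts_succ_of_lt {i : ℕ} (hi : i < T.card) :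
    bpts p T (i + 1) = T.orderEmbOfFin rfl ⟨i, hi⟩ := by
  unfold bpts
  rw [if_neg (by omega), dif_pos (by simpa using hi)]
  congr 1

/-- The middle break points belong to `T`. [cite: ConnesConsani2017ScalingSite, proof of Prop. 5.4 (v)] -/
theorem bpts_mem {i : ℕ} (h1 : 1 ≤ i) (h2 : i ≤ T.card) : bpts p T i ∈ T := by
  obtain ⟨j, rfl⟩ : ∃ j, i = j + 1 := ⟨i - 1, by omega⟩
  rw [bpts_succ_of_lt (by omega)]
  exact T.orderEmbOfFin_mem rfl _

/-- Every element of `T` is a middle break point. [cite: ConnesConsani2017ScalingSite, proof of Prop. 5.4 (v)] -/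
theorem exists_bpts_eq {t : ℝ} (ht : t ∈ T) : ∃ i, 1 ≤ i ∧ i ≤ T.card ∧ bpts p T i = t := by
  have : t ∈ Set.range (T.orderEmbOfFin rfl) := by rw [Finset.range_orderEmbOfFin]; exact ht
  obtain ⟨⟨j, hj⟩, hjt⟩ := this
  exact ⟨j + 1, by omega, by omega, by rw [bpts_succ_of_lt hj]; exact hjt⟩

/-- Strict monotonicity of the break points on `{0, …, N + 1}` when `T ⊂ (1, p)`.
[cite: ConnesConsani2017ScalingSite, proof of Prop. 5.4 (v)] -/
theorem bpts_lt_succ (hp : 1 < p) (hT : ∀ t ∈ T, 1 < t ∧ t < p) {i : ℕ} (hi : i ≤ T.card) :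
    bpts p T i < bpts p T (i + 1) := by
  have hpR : (1 : ℝ) < p := by exact_mod_cast hp
  rcases Nat.eq_zero_or_pos i with rfl | hi0
  · rw [bpts_zero]
    rcases Nat.eq_zero_or_pos T.card with h0 | h0
    · rw [bpts_of_card_lt (by omega)]; exact hpR
    · rw [bpts_succ_of_lt h0]
      exact (hT _ (T.orderEmbOfFin_mem rfl _)).1
  · rcases Nat.lt_or_ge i T.card with h | h
    · obtain ⟨j, rfl⟩ : ∃ j, i = j + 1 := ⟨i - 1, by omega⟩
      rw [bpts_succ_of_lt (by omega), bpts_succ_of_lt h]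
      exact (T.orderEmbOfFin rfl).strictMono (Fin.mk_lt_mk.2 (by omega))
    · have hi' : i = T.card := le_antisymm hi h
      obtain ⟨j, hj⟩ : ∃ j, i = j + 1 := ⟨i - 1, by omega⟩
      have hjc : j < T.card := by omega
      rw [bpts_of_card_lt (by omega : T.card < i + 1), hj, bpts_succ_of_lt hjc]
      exact (hT _ (T.orderEmbOfFin_mem rfl _)).2


/-- Monotonicity of the break points on `{0, …, N + 1}`. [cite: ConnesConsani2017ScalingSite, proof of Prop. 5.4 (v)] -/
theorem bpts_lt_of_lt (hp : 1 < p) (hT : ∀ t ∈ T, 1 < t ∧ t < p) {i j : ℕ} (hij : i < j)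
    (hj : j ≤ T.card + 1) : bpts p T i < bpts p T j :=
  seq_lt_of_lt (lam := bpts p T) (n := T.card) (fun _ hk => bpts_lt_succ hp hT hk) hij hj

/-- Weak monotonicity of the break points. [cite: ConnesConsani2017ScalingSite, proof of Prop. 5.4 (v)] -/
theorem bpts_le_of_le (hp : 1 < p) (hT : ∀ t ∈ T, 1 < t ∧ t < p) {i j : ℕ} (hij : i ≤ j)
    (hj : j ≤ T.card + 1) : bpts p T i ≤ bpts p T j :=
  seq_le_of_le (lam := bpts p T) (n := T.card) (fun _ hk => bpts_lt_succ hp hT hk) hij hj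

/-- `1 ≤ bpts i`. [cite: ConnesConsani2017ScalingSite, proof of Prop. 5.4 (v)] -/
theorem one_le_bpts (hp : 1 < p) (hT : ∀ t ∈ T, 1 < t ∧ t < p) (i : ℕ) : 1 ≤ bpts p T i := by
  rcases Nat.eq_zero_or_pos i with rfl | hi
  · simp
  rcases le_or_gt i (T.card + 1) with h | h
  · rw [← bpts_zero (p := p) (T := T)]
    exact (bpts_lt_of_lt hp hT hi h).le
  · rw [bpts_of_card_lt (by omega)]
    exact_mod_cast hp.le

/-- `bpts i ≤ p`. [cite: ConnesConsani2017ScalingSite, proof of Prop. 5.4 (v)] -/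
theorem bpts_le_p (hp : 1 < p) (hT : ∀ t ∈ T, 1 < t ∧ t < p) (i : ℕ) : bpts p T i ≤ p := by
  rcases lt_or_ge i (T.card + 1) with h | h
  · rw [← bpts_of_card_lt (p := p) (T := T) (Nat.lt_succ_self _)]
    exact (bpts_lt_of_lt hp hT h le_rfl).le
  · rcases h.eq_or_lt with h | h
    · rw [← h, bpts_of_card_lt (Nat.lt_succ_self _)]
    · rw [bpts_of_card_lt (by omega)]

/-- `bpts j < p` for `j ≤ N`. [cite: ConnesConsani2017ScalingSite, proof of Prop. 5.4 (v)] -/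
theorem bpts_lt_p (hp : 1 < p) (hT : ∀ t ∈ T, 1 < t ∧ t < p) {j : ℕ} (hj : j ≤ T.card) :
    bpts p T j < p := by
  rw [← bpts_of_card_lt (p := p) (T := T) (Nat.lt_succ_self _)]
  exact bpts_lt_of_lt hp hT (by omega) le_rfl

/-- No break point lies strictly between two consecutive ones.
[cite: ConnesConsani2017ScalingSite, proof of Prop. 5.4 (v)] -/
theorem not_mem_Ioo_bpts (hp : 1 < p) (hT : ∀ t ∈ T, 1 < t ∧ t < p) {t : ℝ}
    (ht : t ∈ T ∨ t = 1 ∨ t = p) {i : ℕ} (hi : i ≤ T.card) :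
    ¬ (bpts p T i < t ∧ t < bpts p T (i + 1)) := by
  obtain ⟨i', hi', rfl⟩ : ∃ i', i' ≤ T.card + 1 ∧ bpts p T i' = t := by
    rcases ht with ht | rfl | rfl
    · obtain ⟨i', -, h2, h3⟩ := exists_bpts_eq (p := p) ht
      exact ⟨i', by omega, h3⟩
    · exact ⟨0, by omega, bpts_zero⟩
    · exact ⟨T.card + 1, le_rfl, bpts_of_card_lt (Nat.lt_succ_self _)⟩
  rintro ⟨h1, h2⟩
  have h3 : i < i' := by
    by_contra h
    exact absurd h1 (not_lt.2 (bpts_le_of_le hp hT (not_lt.1 h) (by omega)))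
  have h4 : i' < i + 1 := by
    by_contra h
    exact absurd h2 (not_lt.2 (bpts_le_of_le hp hT (not_lt.1 h) hi'))
  omega

end Bpts

/-! ### Piece data on the fundamental domain `[1, p]` from a finite set of break points -/

/-- `fundRed p 1 p = 1`. [cite: ConnesConsani2017ScalingSite, Lemma 5.1 (i)] -/
theorem fundRed_one_p {p : ℕ} (hp : 1 < p) : fundRed p 1 (p : ℝ) = 1 := by
  have hpR : (1 : ℝ) < p := by exact_mod_cast hp
  have h := fundRed_mul_p hp one_pos one_pos (p := p)
  rw [mul_one] at h
  rw [h, fundRed_of_mem hp one_pos le_rfl (by linarith)]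

/-- **Piece data based at `1`** ("Such a function is uniquely determined by its restriction to the
fundamental domain"): if `F` is affine with slopes in `H_p` between consecutive break points
`1 = t₀ < t₁ < ⋯ < t_{N+1} = p` and `F(p) = F(1)`, then the function `g(x) = F(x̄)` (with `x̄` the
representative of `x` in `[1, p)`) has piece data with `λ₀ = 1`.
[cite: ConnesConsani2017ScalingSite, proof of Prop. 5.4 (v)] -/
def CpPieces.ofFinset {p : ℕ} (hp : 1 < p) (T : Finset ℝ) (hT : ∀ t ∈ T, 1 < t ∧ t < p)
    {F g : ℝ → ℝ} (hg : ∀ x, 0 < x → g x = F (fundRed p 1 x)) (hclos : F p = F 1)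
    (s : ℕ → ℝ) (hs : ∀ j, j ≤ T.card → IsPFraction p (s j))
    (haff : ∀ j, j ≤ T.card → ∀ x, bpts p T j ≤ x → x ≤ bpts p T (j + 1) →
      F x = F (bpts p T j) + s j * (x - bpts p T j)) : CpPieces p g where
  n := T.card
  lam := bpts p T
  h := s
  lam_pos := by simp
  lam_lt := fun i hi => bpts_lt_succ hp hT hi
  lam_last := by rw [bpts_of_card_lt (Nat.lt_succ_self _), bpts_zero, mul_one]
  h_mem := hs
  piece := by
    intro j hj x hx1 hx2
    have hj1 : (1 : ℝ) ≤ bpts p T j := one_le_bpts hp hT j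
    have hjp : bpts p T j < p := bpts_lt_p hp hT hj
    have hgx : ∀ y : ℝ, 1 ≤ y → y < p → g y = F y := fun y h1 h2 => by
      rw [hg y (by linarith), fundRed_of_mem hp one_pos h1 (by simpa using h2)]
    rw [hgx _ hj1 hjp]
    rcases lt_or_eq_of_le (hx2.trans (bpts_le_p hp hT (j + 1))) with hlt | heq
    · rw [hgx x (hj1.trans hx1) hlt]
      exact haff j hj x hx1 hx2
    · have := haff j hj x hx1 hx2
      rw [heq] at this ⊢
      rw [hg p (by exact_mod_cast (zero_lt_one.trans hp)), fundRed_one_p hp, ← hclos]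
      exact this

/-- The piece data of `CpPieces.ofFinset` are based at `1` with the given break points.
[cite: ConnesConsani2017ScalingSite, proof of Prop. 5.4 (v)] -/
theorem CpPieces.ofFinset_lam {p : ℕ} (hp : 1 < p) (T : Finset ℝ) (hT : ∀ t ∈ T, 1 < t ∧ t < p)
    {F g : ℝ → ℝ} (hg : ∀ x, 0 < x → g x = F (fundRed p 1 x)) (hclos : F p = F 1)
    (s : ℕ → ℝ) (hs : ∀ j, j ≤ T.card → IsPFraction p (s j))
    (haff : ∀ j, j ≤ T.card → ∀ x, bpts p T j ≤ x → x ≤ bpts p T (j + 1) →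
      F x = F (bpts p T j) + s j * (x - bpts p T j)) :
    (CpPieces.ofFinset hp T hT hg hclos s hs haff).lam = bpts p T ∧
      (CpPieces.ofFinset hp T hT hg hclos s hs haff).n = T.card ∧
      (CpPieces.ofFinset hp T hT hg hclos s hs haff).h = s := ⟨rfl, rfl, rfl⟩

/-- **Rebasing the piece data at `1`** (proof of Prop. 5.4 (v): "`f` is uniquely determined by its
restriction to the fundamental domain"; §5.4 works throughout with "the restriction of `f` to
`[1, p]`"): every `f ∈ 𝒦(C_p)` has piece data with break points `1 = t₀ < t₁ < ⋯ < t_{N+1} = p`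
containing any prescribed finite subset of `(1, p)`, the slopes being the right derivatives.
[cite: ConnesConsani2017ScalingSite, proof of Prop. 5.4 (v) and Prop. 5.15 (iv)] -/
theorem IsCpRational.exists_cpPieces_base_one {p : ℕ} (hp : 1 < p) {f : ℝ → ℝ}
    (hf : IsCpRational p f) (T₀ : Finset ℝ) (hT₀ : ∀ t ∈ T₀, 1 < t ∧ t < p) :
    ∃ (T : Finset ℝ) (_ : ∀ t ∈ T, 1 < t ∧ t < p) (P : CpPieces p f),
      T₀ ⊆ T ∧ P.lam = bpts p T ∧ P.n = T.card ∧
      ∀ j, j ≤ T.card → P.h j = derivWithin f (Ioi (bpts p T j)) (bpts p T j) := by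
  classical
  have hp0 : 0 < p := zero_lt_one.trans hp
  have hpR : (0 : ℝ) < p := by exact_mod_cast hp0
  have hp1 : (1 : ℝ) < p := by exact_mod_cast hp
  obtain ⟨Q⟩ := hf.nonempty_cpPieces
  set T : Finset ℝ := T₀ ∪ ((Finset.range (Q.n + 1)).image
    (fun i => fundRed p 1 (Q.lam i))).filter (fun t => 1 < t) with hTdef
  have hT : ∀ t ∈ T, 1 < t ∧ t < p := by
    intro t ht
    rw [hTdef, Finset.mem_union] at ht
    rcases ht with ht | ht
    · exact hT₀ t ht
    · rw [Finset.mem_filter, Finset.mem_image] at ht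
      obtain ⟨⟨i, hi, rfl⟩, h1⟩ := ht
      refine ⟨h1, ?_⟩
      have hi' : i ≤ Q.n + 1 := by simp only [Finset.mem_range] at hi; omega
      have := (fundRed_spec hp one_pos (Q.lam_pos' hi')).2.1
      simpa using this
  have hkey : ∀ i, i ≤ Q.n → fundRed p 1 (Q.lam i) ∈ T ∨ fundRed p 1 (Q.lam i) = 1 := by
    intro i hi
    have h1 : 1 ≤ fundRed p 1 (Q.lam i) :=
      (fundRed_spec hp one_pos (Q.lam_pos' (i := i) (by omega))).1
    rcases h1.eq_or_lt with h | h
    · exact Or.inr h.symm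
    · left
      rw [hTdef, Finset.mem_union, Finset.mem_filter, Finset.mem_image]
      exact Or.inr ⟨⟨i, Finset.mem_range.2 (by omega), rfl⟩, h⟩
  set s : ℕ → ℝ := fun j => derivWithin f (Ioi (bpts p T j)) (bpts p T j) with hsdef
  have hs : ∀ j, j ≤ T.card → IsPFraction p (s j) := fun j _ =>
    (hf.hasDerivWithinAt_Ioi hp (zero_lt_one.trans_le (one_le_bpts hp hT j))).2
  have haff : ∀ j, j ≤ T.card → ∀ x, bpts p T j ≤ x → x ≤ bpts p T (j + 1) →
      f x = f (bpts p T j) + s j * (x - bpts p T j) := by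
    intro j hj
    have huv : bpts p T j < bpts p T (j + 1) := bpts_lt_succ hp hT hj
    have hu1 : 1 ≤ bpts p T j := one_le_bpts hp hT j
    have hvp : bpts p T (j + 1) ≤ p := bpts_le_p hp hT (j + 1)
    set u := bpts p T j with hu
    set v := bpts p T (j + 1) with hv
    have hu0 : 0 < u := by linarith
    have hx₀0 : 0 < (u + v) / 2 := by linarith
    obtain ⟨k, y, hy0, hy1, hx₀y⟩ := exists_zpow_mul_mem_Ico hp Q.lam_pos hx₀0
    rw [← Q.lam_last] at hy1
    obtain ⟨i, hi, hy2, hy3⟩ := Q.exists_piece_right hy0 hy1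
    have hpk : (0 : ℝ) < (p : ℝ) ^ k := zpow_pos hpR k
    -- Claim A: `p^k λ_i ≤ u`
    have hA : (p : ℝ) ^ k * Q.lam i ≤ u := by
      by_contra hcon
      push Not at hcon
      have hz1 : (p : ℝ) ^ k * Q.lam i ≤ (u + v) / 2 := by
        rw [hx₀y]; exact mul_le_mul_of_nonneg_left hy2 hpk.le
      have hzv : (p : ℝ) ^ k * Q.lam i < v := by linarith
      have hz1' : 1 < (p : ℝ) ^ k * Q.lam i := by linarith
      have hzp : (p : ℝ) ^ k * Q.lam i < p := by linarith
      have hfz : fundRed p 1 ((p : ℝ) ^ k * Q.lam i) = (p : ℝ) ^ k * Q.lam i :=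
        fundRed_of_mem hp one_pos hz1'.le (by simpa using hzp)
      have hfz' : fundRed p 1 ((p : ℝ) ^ k * Q.lam i) = fundRed p 1 (Q.lam i) :=
        fundRed_zpow_mul hp one_pos (Q.lam_pos' (by omega)) k
      have hzT : (p : ℝ) ^ k * Q.lam i ∈ T ∨ (p : ℝ) ^ k * Q.lam i = 1 ∨
          (p : ℝ) ^ k * Q.lam i = (p : ℝ) := by
        rcases hkey i hi with h | h
        · left; rwa [← hfz', hfz] at h
        · right; left; rw [← hfz, hfz', h]
      exact not_mem_Ioo_bpts hp hT hzT hj ⟨hcon, hzv⟩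
    -- Claim B: `v ≤ p^k λ_{i+1}`
    have hB : v ≤ (p : ℝ) ^ k * Q.lam (i + 1) := by
      by_contra hcon
      push Not at hcon
      have hz1 : (u + v) / 2 < (p : ℝ) ^ k * Q.lam (i + 1) := by
        rw [hx₀y]; exact mul_lt_mul_of_pos_left hy3 hpk
      have huz : u < (p : ℝ) ^ k * Q.lam (i + 1) := by linarith
      have hz1' : 1 < (p : ℝ) ^ k * Q.lam (i + 1) := by linarith
      have hzp : (p : ℝ) ^ k * Q.lam (i + 1) < p := by linarith
      have hfz : fundRed p 1 ((p : ℝ) ^ k * Q.lam (i + 1)) = (p : ℝ) ^ k * Q.lam (i + 1) :=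
        fundRed_of_mem hp one_pos hz1'.le (by simpa using hzp)
      have hzT : (p : ℝ) ^ k * Q.lam (i + 1) ∈ T ∨ (p : ℝ) ^ k * Q.lam (i + 1) = 1 ∨
          (p : ℝ) ^ k * Q.lam (i + 1) = (p : ℝ) := by
        rcases Nat.lt_or_ge i Q.n with hin | hin
        · have hfz' : fundRed p 1 ((p : ℝ) ^ k * Q.lam (i + 1)) = fundRed p 1 (Q.lam (i + 1)) :=
            fundRed_zpow_mul hp one_pos (Q.lam_pos' (by omega)) k
          rcases hkey (i + 1) (by omega) with h | h
          · left; rwa [← hfz', hfz] at h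
          · right; left; rw [← hfz, hfz', h]
        · have hi' : i = Q.n := le_antisymm hi hin
          have hfz' : fundRed p 1 ((p : ℝ) ^ k * Q.lam (i + 1)) = fundRed p 1 (Q.lam 0) := by
            rw [hi', Q.lam_last, ← mul_assoc, ← zpow_add_one₀ hpR.ne']
            exact fundRed_zpow_mul hp one_pos Q.lam_pos (k + 1)
          rcases hkey 0 (Nat.zero_le _) with h | h
          · left; rwa [← hfz', hfz] at h
          · right; left; rw [← hfz, hfz', h]
      exact not_mem_Ioo_bpts hp hT hzT hj ⟨huz, hcon⟩
    -- `f` is affine on `[u, v]` with slope `h_i / p^k`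
    have hperk : ∀ t, 0 < t → f ((p : ℝ) ^ k * t) = f t := periodic_zpow hp0 hf.1 k
    have haffine : ∀ x, u ≤ x → x ≤ v →
        f x = f (Q.lam i) + Q.h i / (p : ℝ) ^ k * (x - (p : ℝ) ^ k * Q.lam i) := by
      intro x hx1 hx2
      have h1 : Q.lam i ≤ x / (p : ℝ) ^ k := by rw [le_div_iff₀ hpk]; linarith
      have h2 : x / (p : ℝ) ^ k ≤ Q.lam (i + 1) := by rw [div_le_iff₀ hpk]; linarith
      have hx' : f x = f (x / (p : ℝ) ^ k) := by
        rw [← hperk (x / (p : ℝ) ^ k) (div_pos (by linarith) hpk), mul_div_cancel₀ _ hpk.ne']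
      rw [hx', Q.piece i hi (x / (p : ℝ) ^ k) h1 h2]
      field_simp
    have hsj : s j = Q.h i / (p : ℝ) ^ k := by
      have hd : HasDerivWithinAt f (Q.h i / (p : ℝ) ^ k) (Ioi u) u :=
        hasDerivWithinAt_Ioi_of_affine (δ := v - u)
          (c := f (Q.lam i) + Q.h i / (p : ℝ) ^ k * (u - (p : ℝ) ^ k * Q.lam i)) (by linarith)
          (fun t ht1 ht2 => by rw [haffine t ht1 (by linarith)]; ring)
      exact hd.derivWithin (uniqueDiffWithinAt_Ioi u)
    intro x hx1 hx2
    rw [hsj, haffine x hx1 hx2, haffine u le_rfl huv.le]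
    ring
  have hg : ∀ x, 0 < x → f x = f (fundRed p 1 x) := fun x hx =>
    hf.apply_eq_apply_fundRed hp one_pos hx
  have hclos : f p = f 1 := by have := hf.1 1 one_pos; rwa [mul_one] at this
  refine ⟨T, hT, CpPieces.ofFinset hp T hT hg hclos s hs haff, ?_, rfl, rfl, fun j _ => rfl⟩
  intro t ht
  rw [hTdef]
  exact Finset.mem_union_left _ ht

/-! ### The `p`-adic size of the slopes (Def. 5.14) -/

section Padic

variable {p : ℕ} [hp : Fact p.Prime]

/-- The `p`-adic absolute value of `a / p^n ∈ H_p` is `|a|_p · p^n` (normalisation `|p|_p = 1/p`,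
§5.4 before Def. 5.14); in particular `pFractionPadicNorm` does not depend on the representation.
[cite: ConnesConsani2017ScalingSite, §5.4 (before Def. 5.14)] -/
theorem pFractionPadicNorm_eq {x : ℝ} {a : ℤ} {n : ℕ} (h : x = (a : ℝ) / (p : ℝ) ^ n) :
    pFractionPadicNorm p x = ((padicNorm p a * (p : ℚ) ^ n : ℚ) : ℝ) := by
  classical
  have hx : IsPFraction p x := ⟨a, n, h⟩
  unfold pFractionPadicNorm
  rw [dif_pos hx]
  set a' : ℤ := Classical.choose hx with ha'
  set n' : ℕ := Classical.choose (Classical.choose_spec hx) with hn'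
  have h' : x = (a' : ℝ) / (p : ℝ) ^ n' := Classical.choose_spec (Classical.choose_spec hx)
  have hpq : (p : ℚ) ≠ 0 := by exact_mod_cast hp.out.ne_zero
  have heq : ((a' : ℚ) / (p : ℚ) ^ n') = (a : ℚ) / (p : ℚ) ^ n := by
    have : (((a' : ℚ) / (p : ℚ) ^ n' : ℚ) : ℝ) = (((a : ℚ) / (p : ℚ) ^ n : ℚ) : ℝ) := by
      push_cast
      rw [← h', ← h]
    exact_mod_cast this
  congr 1
  rw [heq, padicNorm.div, IsAbsoluteValue.abv_pow (padicNorm p), padicNorm.padicNorm_p_of_prime,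
    inv_pow, div_inv_eq_mul]

/-- `|a/p^n|_p ≤ p^n` for an integer `a`. [cite: ConnesConsani2017ScalingSite, §5.4 (before Def. 5.14)] -/
theorem pFractionPadicNorm_intCast_div_le (a : ℤ) (n : ℕ) :
    pFractionPadicNorm p ((a : ℝ) / (p : ℝ) ^ n) ≤ (p : ℝ) ^ n := by
  rw [pFractionPadicNorm_eq rfl]
  have h1 : padicNorm p a ≤ 1 := padicNorm.of_int a
  have h2 : (0 : ℚ) ≤ (p : ℚ) ^ n := by positivity
  have : padicNorm p a * (p : ℚ) ^ n ≤ (p : ℚ) ^ n := by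
    calc padicNorm p a * (p : ℚ) ^ n ≤ 1 * (p : ℚ) ^ n := mul_le_mul_of_nonneg_right h1 h2
      _ = (p : ℚ) ^ n := one_mul _
  exact_mod_cast this

omit hp in
/-- `pFractionPadicNorm` is nonnegative. [cite: ConnesConsani2017ScalingSite, Def. 5.14] -/
theorem pFractionPadicNorm_nonneg (x : ℝ) : 0 ≤ pFractionPadicNorm p x := by
  classical
  unfold pFractionPadicNorm
  split_ifs
  · exact_mod_cast padicNorm.nonneg _
  · exact le_rfl

/-- **Integrality from the `p`-adic bound** (the computation in the proof of Prop. 5.15 (iv): "if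
`‖f‖_p ≤ 1` one has `|h(λ)|_p < p` for all `λ ∈ [1,p)` and thus, since `h(λ) ∈ H_p`, one gets
`h(λ) ∈ ℤ`"), scaled by `p^m`: if `h ∈ H_p` and `|h|_p < p^{m+1}` then `h ∈ p^{-m} ℤ`.
[cite: ConnesConsani2017ScalingSite, Prop. 5.15 (iv) (proof)] -/
theorem exists_eq_intCast_div_of_pFractionPadicNorm_lt {h : ℝ} (hh : IsPFraction p h) {m : ℕ}
    (hlt : pFractionPadicNorm p h < (p : ℝ) ^ (m + 1)) : ∃ z : ℤ, h = (z : ℝ) / (p : ℝ) ^ m := by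
  obtain ⟨a, n, rfl⟩ := hh
  have hp1 : 1 < p := hp.out.one_lt
  have hpR : (0 : ℝ) < p := by exact_mod_cast hp.out.pos
  have hpQ : (1 : ℚ) < p := by exact_mod_cast hp1
  rcases le_or_gt n m with hnm | hnm
  · refine ⟨a * p ^ (m - n), ?_⟩
    push_cast
    rw [div_eq_div_iff (pow_ne_zero _ hpR.ne') (pow_ne_zero _ hpR.ne')]
    have e : (p : ℝ) ^ (m - n) * (p : ℝ) ^ n = (p : ℝ) ^ m := by
      rw [← pow_add, Nat.sub_add_cancel hnm]
    calc (a : ℝ) * (p : ℝ) ^ m = a * ((p : ℝ) ^ (m - n) * (p : ℝ) ^ n) := by rw [e]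
      _ = _ := by ring
  · -- `n > m`: the bound forces `p^(n-m) ∣ a`
    rcases eq_or_ne a 0 with rfl | ha
    · exact ⟨0, by simp⟩
    rw [pFractionPadicNorm_eq rfl] at hlt
    have hlt' : padicNorm p a * (p : ℚ) ^ n < (p : ℚ) ^ (m + 1) := by exact_mod_cast hlt
    obtain ⟨v, hv⟩ := padicNorm.values_discrete (p := p) (q := (a : ℚ)) (by exact_mod_cast ha)
    have hdvd : ((p ^ (n - m) : ℕ) : ℤ) ∣ a := by
      rw [padicNorm.dvd_iff_norm_le, hv, zpow_le_zpow_iff_right₀ hpQ]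
      rw [hv] at hlt'
      have : (p : ℚ) ^ (-v) < (p : ℚ) ^ ((m : ℤ) + 1 - n) := by
        have e : (p : ℚ) ^ ((m : ℤ) + 1 - n) = (p : ℚ) ^ (m + 1) / (p : ℚ) ^ n := by
          rw [zpow_sub₀ (by positivity), zpow_natCast]
          norm_cast
        rw [e, lt_div_iff₀ (by positivity)]
        exact hlt'
      rw [zpow_lt_zpow_iff_right₀ hpQ] at this
      omega
    obtain ⟨b, hb⟩ := hdvd
    refine ⟨b, ?_⟩
    rw [hb]
    push_cast
    rw [div_eq_div_iff (pow_ne_zero _ hpR.ne') (pow_ne_zero _ hpR.ne')]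
    have e : (p : ℝ) ^ (n - m) * (p : ℝ) ^ m = (p : ℝ) ^ n := by
      rw [← pow_add, Nat.sub_add_cancel hnm.le]
    calc _ = (b : ℝ) * ((p : ℝ) ^ (n - m) * (p : ℝ) ^ m) := by ring
      _ = _ := by rw [e]

end Padic

/-! ### Slopes on `[1, p]` of a function with piece data based at `1` -/

section SlopesAtOne

variable {p : ℕ} {f : ℝ → ℝ} {T : Finset ℝ}

/-- With piece data based at `1`: the right slope at a point of `[t_j, t_{j+1})` is `h_j`.
[cite: ConnesConsani2017ScalingSite, Prop. 5.15 (iv) (proof)] -/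
theorem CpPieces.derivWithin_Ioi_eq (P : CpPieces p f) (hPl : P.lam = bpts p T) (hPn : P.n = T.card)
    {j : ℕ} (hj : j ≤ T.card) {x : ℝ} (h1 : bpts p T j ≤ x) (h2 : x < bpts p T (j + 1)) :
    derivWithin f (Ioi x) x = P.h j :=
  (P.hasDerivWithinAt_Ioi (hPn ▸ hj) (hPl ▸ h1) (hPl ▸ h2)).derivWithin (uniqueDiffWithinAt_Ioi x)

/-- With piece data based at `1`: the left slope at a point of `(t_j, t_{j+1}]` is `h_j`.
[cite: ConnesConsani2017ScalingSite, Prop. 5.15 (iv) (proof)] -/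
theorem CpPieces.derivWithin_Iio_eq (P : CpPieces p f) (hPl : P.lam = bpts p T) (hPn : P.n = T.card)
    {j : ℕ} (hj : j ≤ T.card) {x : ℝ} (h1 : bpts p T j < x) (h2 : x ≤ bpts p T (j + 1)) :
    derivWithin f (Iio x) x = P.h j :=
  (P.hasDerivWithinAt_Iio (hPn ▸ hj) (hPl ▸ h1) (hPl ▸ h2)).derivWithin (uniqueDiffWithinAt_Iio x)

/-- The right slope at `p` is `h_0 / p` ("`h_±(pλ) = h_±(λ)/p`").
[cite: ConnesConsani2017ScalingSite, §5.4 (before Def. 5.14)] -/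
theorem CpPieces.derivWithin_Ioi_p (hp : 1 < p) (P : CpPieces p f) (hPl : P.lam = bpts p T)
    (hper : ∀ t, 0 < t → f (p * t) = f t) :
    derivWithin f (Ioi (p : ℝ)) p = P.h 0 / p := by
  have hpR : (0 : ℝ) < p := by exact_mod_cast zero_lt_one.trans hp
  have h1 : HasDerivWithinAt f (P.h 0) (Ioi 1) 1 := by
    have := P.hasDerivWithinAt_Ioi (Nat.zero_le _) (le_of_eq rfl) (P.lam_lt 0 (Nat.zero_le _))
    rwa [hPl, bpts_zero] at this
  have := hasDerivWithinAt_Ioi_scale hpR hper one_pos h1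
  rw [mul_one] at this
  exact this.derivWithin (uniqueDiffWithinAt_Ioi _)

/-- The left slope at `1` is `p h_N`. [cite: ConnesConsani2017ScalingSite, proof of Prop. 5.4 (v) ("`ph_n` is the slope … in `(1/p) I_n`")] -/
theorem CpPieces.derivWithin_Iio_one (hp : 1 < p) (P : CpPieces p f) (hPl : P.lam = bpts p T)
    (hPn : P.n = T.card) (hper : ∀ t, 0 < t → f (p * t) = f t) :
    derivWithin f (Iio (1 : ℝ)) 1 = p * P.h T.card := by
  have := P.hasDerivWithinAt_Iio_zero (zero_lt_one.trans hp) hper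
  rw [hPl, bpts_zero, hPn] at this
  exact this.derivWithin (uniqueDiffWithinAt_Iio _)

/-- Locating a point of `[1, p)` in a piece. [cite: ConnesConsani2017ScalingSite, proof of Prop. 5.4 (v)] -/
theorem exists_bpts_piece_right {x : ℝ} (h1 : 1 ≤ x) (h2 : x < (p : ℝ)) : ∃ j, j ≤ T.card ∧ bpts p T j ≤ x ∧ x < bpts p T (j + 1) := by
  classical
  -- reuse the generic lemma through a dummy `CpPieces`-free argument: `Nat.findGreatest`
  set j := Nat.findGreatest (fun i => bpts p T i ≤ x) T.card with hjdef
  have hj : bpts p T j ≤ x :=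
    Nat.findGreatest_spec (P := fun i => bpts p T i ≤ x) (Nat.zero_le _) (by simpa using h1)
  refine ⟨j, Nat.findGreatest_le _, hj, ?_⟩
  by_contra hcon
  push Not at hcon
  have hjn : j ≤ T.card := Nat.findGreatest_le _
  rcases Nat.lt_or_ge j T.card with h | h
  · have := Nat.le_findGreatest (P := fun i => bpts p T i ≤ x) (show j + 1 ≤ T.card by omega) hcon
    omega
  · have : j = T.card := le_antisymm hjn h
    rw [this, bpts_of_card_lt (Nat.lt_succ_self _)] at hcon
    linarith

/-- Locating a point of `(1, p]` in a piece (from the left). [cite: ConnesConsani2017ScalingSite, proof of Prop. 5.4 (v)] -/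
theorem exists_bpts_piece_left {x : ℝ} (h1 : 1 < x) (h2 : x ≤ (p : ℝ)) : ∃ j, j ≤ T.card ∧ bpts p T j < x ∧ x ≤ bpts p T (j + 1) := by
  classical
  set j := Nat.findGreatest (fun i => bpts p T i < x) T.card with hjdef
  have hj : bpts p T j < x :=
    Nat.findGreatest_spec (P := fun i => bpts p T i < x) (Nat.zero_le _) (by simpa using h1)
  refine ⟨j, Nat.findGreatest_le _, hj, ?_⟩
  by_contra hcon
  push Not at hcon
  have hjn : j ≤ T.card := Nat.findGreatest_le _
  rcases Nat.lt_or_ge j T.card with h | h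
  · have := Nat.le_findGreatest (P := fun i => bpts p T i < x) (show j + 1 ≤ T.card by omega) hcon
    omega
  · have : j = T.card := le_antisymm hjn h
    rw [this, bpts_of_card_lt (Nat.lt_succ_self _)] at hcon
    linarith

end SlopesAtOne

/-! ### Prop. 5.15 (iv), scaled: `‖f‖_p ≤ p^m` iff the slopes on `[1, p)` lie in `p^{-m} ℤ` -/

section Level

variable {p : ℕ} [hp : Fact p.Prime] {f : ℝ → ℝ} {T : Finset ℝ}

/-- **Prop. 5.15 (iv) (⇒), scaled by Frobenius as in Lemma 5.18 (ii)**: if `‖f‖_p ≤ p^m` then every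
slope of `f` on `[1, p)` lies in `p^{-m} ℤ` ("if `‖f‖_p ≤ 1` … one gets `h(λ) ∈ ℤ` for all
`λ ∈ [1,p)`"). [cite: ConnesConsani2017ScalingSite, Prop. 5.15 (iv) and Lemma 5.18 (ii)] -/
theorem CpPieces.exists_h_eq_div_pow_of_cpSlopeNorm_le (hf : IsCpRational p f) (P : CpPieces p f)
    (hPl : P.lam = bpts p T) (hPn : P.n = T.card) (hT : ∀ t ∈ T, 1 < t ∧ t < p) {m : ℕ}
    (hnorm : cpSlopeNorm p f ≤ (p : ℝ) ^ m) {j : ℕ} (hj : j ≤ T.card) :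
    ∃ z : ℤ, P.h j = (z : ℝ) / (p : ℝ) ^ m := by
  have hp1 : 1 < p := hp.out.one_lt
  have hpR : (0 : ℝ) < p := by exact_mod_cast hp.out.pos
  -- the set of Definition 5.14 is bounded above
  set S := ((fun x => pFractionPadicNorm p (derivWithin f (Ioi x) x) / x) '' Icc (1 : ℝ) p) ∪
    ((fun x => pFractionPadicNorm p (derivWithin f (Iio x) x) / x) '' Icc (1 : ℝ) p) with hS
  set C : ℝ := (∑ i ∈ Finset.range (T.card + 1), pFractionPadicNorm p (P.h i)) +
    pFractionPadicNorm p (P.h 0 / p) + pFractionPadicNorm p (p * P.h T.card) with hC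
  have hCi : ∀ i, i ≤ T.card → pFractionPadicNorm p (P.h i) ≤ C := by
    intro i hi
    have h1 : pFractionPadicNorm p (P.h i) ≤
        ∑ i ∈ Finset.range (T.card + 1), pFractionPadicNorm p (P.h i) :=
      Finset.single_le_sum (f := fun i => pFractionPadicNorm p (P.h i))
        (fun i _ => pFractionPadicNorm_nonneg _) (Finset.mem_range.2 (by omega))
    have h2 := pFractionPadicNorm_nonneg (p := p) (P.h 0 / p)
    have h3 := pFractionPadicNorm_nonneg (p := p) (p * P.h T.card)
    linarith
  have hsum_nonneg : 0 ≤ ∑ i ∈ Finset.range (T.card + 1), pFractionPadicNorm p (P.h i) :=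
    Finset.sum_nonneg fun i _ => pFractionPadicNorm_nonneg _
  have hbdd : BddAbove S := by
    refine ⟨C, ?_⟩
    rintro b hb
    have key : ∀ (x v : ℝ), 1 ≤ x → pFractionPadicNorm p v ≤ C → pFractionPadicNorm p v / x ≤ C := by
      intro x v hx hv
      rw [div_le_iff₀ (by linarith)]
      have := pFractionPadicNorm_nonneg (p := p) v
      nlinarith
    rcases hb with ⟨x, hx, rfl⟩ | ⟨x, hx, rfl⟩
    · apply key x _ hx.1
      rcases hx.2.lt_or_eq with hlt | heq
      · obtain ⟨i, hi, hi1, hi2⟩ := exists_bpts_piece_right (T := T) hx.1 hlt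
        rw [P.derivWithin_Ioi_eq hPl hPn hi hi1 hi2]
        exact hCi i hi
      · rw [heq, P.derivWithin_Ioi_p hp1 hPl hf.1]
        have h2 := pFractionPadicNorm_nonneg (p := p) (p * P.h T.card)
        linarith [hsum_nonneg]
    · apply key x _ hx.1
      rcases hx.1.lt_or_eq with hlt | heq
      · obtain ⟨i, hi, hi1, hi2⟩ := exists_bpts_piece_left (T := T) hlt hx.2
        rw [P.derivWithin_Iio_eq hPl hPn hi hi1 hi2]
        exact hCi i hi
      · rw [← heq, P.derivWithin_Iio_one hp1 hPl hPn hf.1]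
        have h2 := pFractionPadicNorm_nonneg (p := p) (P.h 0 / p)
        linarith [hsum_nonneg]
  -- the midpoint of the `j`-th piece
  set x := (bpts p T j + bpts p T (j + 1)) / 2 with hx
  have hlt : bpts p T j < bpts p T (j + 1) := bpts_lt_succ hp1 hT hj
  have hx1 : bpts p T j ≤ x := by rw [hx]; linarith
  have hx2 : x < bpts p T (j + 1) := by rw [hx]; linarith
  have h1x : 1 ≤ x := (one_le_bpts hp1 hT j).trans hx1
  have hxp : x < p := hx2.trans_le (bpts_le_p hp1 hT (j + 1))
  have hmem : pFractionPadicNorm p (P.h j) / x ∈ S := by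
    left
    refine ⟨x, ⟨h1x, hxp.le⟩, ?_⟩
    simp only
    rw [P.derivWithin_Ioi_eq hPl hPn hj hx1 hx2]
  have hle : pFractionPadicNorm p (P.h j) / x ≤ (p : ℝ) ^ m :=
    (le_csSup hbdd hmem).trans hnorm
  rw [div_le_iff₀ (by linarith)] at hle
  have hlt' : pFractionPadicNorm p (P.h j) < (p : ℝ) ^ (m + 1) := by
    calc pFractionPadicNorm p (P.h j) ≤ (p : ℝ) ^ m * x := hle
      _ < (p : ℝ) ^ m * p := mul_lt_mul_of_pos_left hxp (pow_pos hpR m)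
      _ = (p : ℝ) ^ (m + 1) := by rw [pow_succ]
  exact exists_eq_intCast_div_of_pFractionPadicNorm_lt (P.h_mem j (by omega)) hlt'

/-- **Prop. 5.15 (iv) (⇐), scaled**: if the slopes of `f` on `[1, p)` lie in `p^{-m} ℤ` then
`‖f‖_p ≤ p^m` (at `λ = p` the slope is `h_0/p` and `|h_0/p|_p / p = |h_0|_p`; at `λ = 1` from
the left it is `p h_N`). [cite: ConnesConsani2017ScalingSite, Prop. 5.15 (iv) (proof)] -/
theorem CpPieces.cpSlopeNorm_le_of_h_eq (hf : IsCpRational p f) (P : CpPieces p f)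
    (hPl : P.lam = bpts p T) (hPn : P.n = T.card) {m : ℕ}
    (z : ℕ → ℤ) (hz : ∀ j, j ≤ T.card → P.h j = (z j : ℝ) / (p : ℝ) ^ m) :
    cpSlopeNorm p f ≤ (p : ℝ) ^ m := by
  have hp1 : 1 < p := hp.out.one_lt
  have hpR : (0 : ℝ) < p := by exact_mod_cast hp.out.pos
  have hp1R : (1 : ℝ) ≤ p := by exact_mod_cast hp1.le
  unfold cpSlopeNorm
  refine csSup_le ?_ ?_
  · exact ⟨_, Or.inl ⟨1, ⟨le_rfl, hp1R⟩, rfl⟩⟩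
  rintro b hb
  have key : ∀ (x : ℝ) (j : ℕ), 1 ≤ x → j ≤ T.card → pFractionPadicNorm p (P.h j) / x ≤ (p : ℝ) ^ m := by
    intro x j hx hj
    rw [div_le_iff₀ (by linarith), hz j hj]
    have := pFractionPadicNorm_intCast_div_le (p := p) (z j) m
    have h0 : (0 : ℝ) ≤ (p : ℝ) ^ m := by positivity
    nlinarith
  rcases hb with ⟨x, hx, rfl⟩ | ⟨x, hx, rfl⟩
  · simp only
    rcases hx.2.lt_or_eq with hlt | heq
    · obtain ⟨i, hi, hi1, hi2⟩ := exists_bpts_piece_right (T := T) hx.1 hlt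
      rw [P.derivWithin_Ioi_eq hPl hPn hi hi1 hi2]
      exact key x i hx.1 hi
    · rw [heq, P.derivWithin_Ioi_p hp1 hPl hf.1, hz 0 (Nat.zero_le _),
        div_le_iff₀ hpR]
      have e : ((z 0 : ℝ) / (p : ℝ) ^ m / p) = (z 0 : ℝ) / (p : ℝ) ^ (m + 1) := by
        rw [div_div, pow_succ]
      rw [e]
      have := pFractionPadicNorm_intCast_div_le (p := p) (z 0) (m + 1)
      rw [pow_succ] at this
      exact this
  · simp only
    rcases hx.1.lt_or_eq with hlt | heq
    · obtain ⟨i, hi, hi1, hi2⟩ := exists_bpts_piece_left (T := T) hlt hx.2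
      rw [P.derivWithin_Iio_eq hPl hPn hi hi1 hi2]
      exact key x i hx.1 hi
    · rw [← heq, P.derivWithin_Iio_one hp1 hPl hPn hf.1, hz T.card le_rfl, div_one]
      have e : (p : ℝ) * ((z T.card : ℝ) / (p : ℝ) ^ m) = ((p * z T.card : ℤ) : ℝ) / (p : ℝ) ^ m := by
        push_cast; ring
      rw [e]
      exact pFractionPadicNorm_intCast_div_le (p := p) _ m

end Level

/-! ### Hinge functions `x ↦ max (x - c) 0` and their one-sided slopes -/

/-- The hinge function `(x - c)₊`. [cite: ConnesConsani2017ScalingSite, Lemma 5.19 (ii) (the functions `φ_a = max{-a(x-1), b(x-p)}`)] -/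
def hinge (c x : ℝ) : ℝ := max (x - c) 0

/-- `(x - c)₊ = x - c` for `c ≤ x`. [cite: ConnesConsani2017ScalingSite, Lemma 5.19 (ii)] -/
theorem hinge_of_le {c x : ℝ} (h : c ≤ x) : hinge c x = x - c := by
  unfold hinge; exact max_eq_left (by linarith)

/-- `(x - c)₊ = 0` for `x ≤ c`. [cite: ConnesConsani2017ScalingSite, Lemma 5.19 (ii)] -/
theorem hinge_of_ge {c x : ℝ} (h : x ≤ c) : hinge c x = 0 := by
  unfold hinge; exact max_eq_right (by linarith)

/-- The hinge is continuous (jointly in `(c, x)` through `max`). [cite: ConnesConsani2017ScalingSite, Lemma 5.19 (iii) ("continuous and injective")] -/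
theorem continuous_hinge (c : ℝ) : Continuous (hinge c) := by
  unfold hinge; fun_prop

/-- Right slope of the hinge: `1` if `c ≤ x`, `0` if `x < c`.
[cite: ConnesConsani2017ScalingSite, Lemma 5.19 (iii) (slopes of `ψ_j`)] -/
theorem hasDerivWithinAt_hinge_Ioi (c x : ℝ) :
    HasDerivWithinAt (hinge c) (if c ≤ x then 1 else 0) (Ioi x) x := by
  split_ifs with h
  · apply hasDerivWithinAt_Ioi_of_affine (δ := 1) (c := x - c) one_pos
    intro t ht1 _
    rw [hinge_of_le (h.trans ht1)]; ring
  · push Not at h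
    apply hasDerivWithinAt_Ioi_of_affine (δ := c - x) (c := 0) (by linarith)
    intro t _ ht2
    rw [hinge_of_ge (by linarith)]; ring

/-- Left slope of the hinge: `1` if `c < x`, `0` if `x ≤ c`.
[cite: ConnesConsani2017ScalingSite, Lemma 5.19 (iii) (slopes of `ψ_j`)] -/
theorem hasDerivWithinAt_hinge_Iio (c x : ℝ) :
    HasDerivWithinAt (hinge c) (if c < x then 1 else 0) (Iio x) x := by
  split_ifs with h
  · apply hasDerivWithinAt_Iio_of_affine (δ := x - c) (c := 0) (x₀ := c) (by linarith)
    intro t ht1 _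
    rw [hinge_of_le (by linarith)]; ring
  · push Not at h
    apply hasDerivWithinAt_Iio_of_affine (δ := 1) (c := 0) (x₀ := x) one_pos
    intro t _ ht2
    rw [hinge_of_ge (ht2.trans h)]; ring

end Literature.NumberTheory.ConnesConsani
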